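import Summits.Ventures.Crystal3D.Bulk.RotSysDelete
import Summits.Ventures.Crystal3D.Bulk.RotSysMerge
import HarnessLib

/-!
# Deleting one edge from a sub-rotation-system: the component count grows by at most one
# (generic brick (G1c), part (K), of `phase2/LEAN-FACES-DESIGN.md` §5.4)

HONEST FRAMING. Part of the venture `Summits/Ventures/Crystal3D` (cell `pub-crystal3d`, phase 2;
seat typer-bulk-2), PURELY COMBINATORIAL and generic (folklore). Continuing
`Bulk/RotSysDelete.lean`: for a loopless rotation system `(σ, α)`, an `α`-closed `S`, `d ∈ S`,
`e = {d, α d}`, `S′ = S ∖ e`: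

* `IsRotSys.numK_sdiff_le_succ`: **`numK S′ ≤ numClasses (conn S) S′ + 1`**, hence
  `numK S′ ≤ numK S + 1` (`IsRotSys.numK_sdiff_le_numK_succ`) — the component of `d` splits into
  at most two (the surviving darts at the vertex of `d` and at the vertex of `α d`,
  `IsRotSys.exists_near_of_conn`);
* `IsRotSys.numK_sdiff_le_of_near_conn`: if moreover any two surviving darts at the two
  end-vertices of `e` are `S′`-connected (e.g. the MERGE case, where one face of `S′` passes through
  both), then **`numK S′ ≤ numClasses (conn S) S′ ≤ numK S`** — no split at all.

Counting tools from `Bulk/RotSysMerge.lean` (`card_image_filter_add`). The face count (F) and the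
assembled inequality are NOT here.
-/

namespace Summit.Ventures.Crystal3D

namespace RotSys

open Equiv Equiv.Perm Finset

variable {D : Type*} [DecidableEq D]

section K

open scoped Classical

variable {σ α : Perm D} {S : Finset D} {d : D}

/-- On `S ∖ e`, outside the component of `d`, the `S ∖ e`-class IS the `S`-class. -/
theorem IsRotSys.filter_conn_sdiff_eq (h : IsRotSys σ α) (hS : IsClosed α S) (hd : d ∈ S)
    {x : D} (hx : x ∈ S \ {d, α d}) (hxd : ¬ conn σ α S x d) :
    ((S \ {d, α d}).filter fun y => conn σ α (S \ {d, α d}) x y) =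
      (S \ {d, α d}).filter fun y => conn σ α S x y := by
  have _ := h
  have _ := hx
  ext y
  simp only [Finset.mem_filter]
  constructor
  · rintro ⟨hy, hc⟩
    exact ⟨hy, conn_mono Finset.sdiff_subset hc⟩
  · rintro ⟨hy, hc⟩
    refine ⟨hy, ?_⟩
    rcases conn_sdiff_or hS hd hc with h1 | ⟨h1, -⟩
    · exact h1
    · exact absurd h1 hxd

/-- On `S ∖ e`, inside the component of `d`, the `S`-class is the whole trace of that component. -/
theorem filter_conn_eq_of_conn (S : Finset D) (d : D) {x : D} (hxd : conn σ α S x d) :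
    ((S \ {d, α d}).filter fun y => conn σ α S x y) =
      (S \ {d, α d}).filter fun y => conn σ α S y d := by
  ext y
  simp only [Finset.mem_filter]
  constructor
  · rintro ⟨hy, hc⟩
    exact ⟨hy, conn_trans (conn_symm hc) hxd⟩
  · rintro ⟨hy, hc⟩
    exact ⟨hy, conn_trans hxd (conn_symm hc)⟩

/-- An `S ∖ e`-class of a dart in the component of `d` lies inside that component. -/
theorem conn_d_of_conn_sdiff {x y : D} (hxd : conn σ α S x d)
    (hc : conn σ α (S \ {d, α d}) x y) : conn σ α S y d :=
  conn_trans (conn_symm (conn_mono Finset.sdiff_subset hc)) hxd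

/-- **(K, upper half)** `numK (S ∖ e) ≤ numClasses (conn S) (S ∖ e) + 1`: deleting an edge
splits its component into at most two (for a loopless system, `S` `α`-closed, `d ∈ S`). -/
theorem IsRotSys.numK_sdiff_le_succ (h : IsRotSys σ α) (hS : IsClosed α S) (hd : d ∈ S) :
    numK σ α (S \ {d, α d}) ≤ numClasses (conn σ α S) (S \ {d, α d}) + 1 := by
  set T := S \ {d, α d} with hT
  set A : D → Prop := fun x => conn σ α S x d with hA
  set cl' : D → Finset D := fun x => T.filter fun y => conn σ α T x y with hcl'
  set cl : D → Finset D := fun x => T.filter fun y => conn σ α S x y with hcl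
  -- images split along `A`; the two parts have disjoint images for both class maps
  have hdisj' : ∀ x ∈ T, ∀ y ∈ T, A x → ¬ A y → cl' x ≠ cl' y := by
    intro x hx y hy hax hay hxy
    have hyx : y ∈ cl' x := by
      rw [hxy]; exact Finset.mem_filter.2 ⟨hy, conn_refl σ α T y⟩
    exact hay (conn_d_of_conn_sdiff hax (Finset.mem_filter.1 hyx).2)
  have hdisj : ∀ x ∈ T, ∀ y ∈ T, A x → ¬ A y → cl x ≠ cl y := by
    intro x hx y hy hax hay hxy
    have hyx : y ∈ cl x := by
      rw [hxy]; exact Finset.mem_filter.2 ⟨hy, conn_refl σ α S y⟩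
    exact hay (conn_trans (conn_symm (Finset.mem_filter.1 hyx).2) hax)
  have e1 : numK σ α T = ((T.filter A).image cl').card +
      ((T.filter fun x => ¬ A x).image cl').card := by
    unfold numK numClasses
    exact card_image_filter_add T cl' A hdisj'
  have e2 : numClasses (conn σ α S) T = ((T.filter A).image cl).card +
      ((T.filter fun x => ¬ A x).image cl).card := by
    unfold numClasses
    exact card_image_filter_add T cl A hdisj
  -- outside `A` the two class maps agree
  have e3 : (T.filter fun x => ¬ A x).image cl' = (T.filter fun x => ¬ A x).image cl := by
    refine Finset.image_congr fun x hx => ?_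
    rw [Finset.mem_coe, Finset.mem_filter] at hx
    exact h.filter_conn_sdiff_eq hS hd hx.1 hx.2
  -- inside `A`: at most two `S ∖ e`-classes (near `v(d)` or near `v(α d)`)
  have e4 : ((T.filter A).image cl').card ≤ 2 := by
    -- every class is the class of a near dart
    have hsub : (T.filter A).image cl' ⊆
        ((T.filter fun w => σ.SameCycle d w).image cl') ∪
          ((T.filter fun w => σ.SameCycle (α d) w).image cl') := by
      intro C hC
      rw [Finset.mem_image] at hC
      obtain ⟨x, hx, rfl⟩ := hC
      rw [Finset.mem_filter] at hx
      obtain ⟨w, hw, hcw, hnear⟩ := h.exists_near_of_conn hS hx.1 hx.2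
      have hcl_eq : cl' x = cl' w := by
        simp only [hcl']
        exact filter_eq_filter_of_rel (S := T) (R := fun a b => conn σ α T a b)
          (fun _ _ _ _ hc => conn_symm hc) (fun _ _ _ _ _ _ h1 h2 => conn_trans h1 h2) hx.1 hw hcw
      rw [Finset.mem_union, hcl_eq]
      rcases hnear with hn | hn
      · exact Or.inl (Finset.mem_image.2 ⟨w, Finset.mem_filter.2 ⟨hw, hn⟩, rfl⟩)
      · exact Or.inr (Finset.mem_image.2 ⟨w, Finset.mem_filter.2 ⟨hw, hn⟩, rfl⟩)
    -- darts of `T` at one vertex are `T`-connected: each of the two images has ≤ 1 element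
    have hone : ∀ v : D, ((T.filter fun w => σ.SameCycle v w).image cl').card ≤ 1 := by
      intro v
      refine card_image_le_one_of_forall_eq _ _ fun w hw w' hw' => ?_
      rw [Finset.mem_filter] at hw hw'
      simp only [hcl']
      exact filter_eq_filter_of_rel (S := T) (R := fun a b => conn σ α T a b)
        (fun _ _ _ _ hc => conn_symm hc) (fun _ _ _ _ _ _ h1 h2 => conn_trans h1 h2) hw.1 hw'.1
        (conn_of_sameCycle hw.1 hw'.1 (hw.2.symm.trans hw'.2))
    calc ((T.filter A).image cl').card
        ≤ (((T.filter fun w => σ.SameCycle d w).image cl') ∪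
            ((T.filter fun w => σ.SameCycle (α d) w).image cl')).card := Finset.card_le_card hsub
      _ ≤ ((T.filter fun w => σ.SameCycle d w).image cl').card +
            ((T.filter fun w => σ.SameCycle (α d) w).image cl').card := Finset.card_union_le _ _
      _ ≤ 1 + 1 := Nat.add_le_add (hone d) (hone (α d))
  -- inside `A` for `cl`: exactly one class if `A` meets `T`, none otherwise; in any case ≥ #… − 1
  have e5 : ((T.filter A).image cl').card ≤ ((T.filter A).image cl).card + 1 := by
    by_cases hne : (T.filter A).Nonempty
    · have : 1 ≤ ((T.filter A).image cl).card := Finset.card_pos.2 (hne.image _)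
      omega
    · rw [Finset.not_nonempty_iff_eq_empty] at hne
      rw [hne]
      simp
  rw [e1, e2, e3]
  omega

/-- Hence **`numK (S ∖ e) ≤ numK S + 1`**. -/
theorem IsRotSys.numK_sdiff_le_numK_succ (h : IsRotSys σ α) (hS : IsClosed α S) (hd : d ∈ S) :
    numK σ α (S \ {d, α d}) ≤ numK σ α S + 1 := by
  have h1 := h.numK_sdiff_le_succ hS hd
  have h2 := h.numClasses_conn_sdiff hS hd
  have h3 : numClasses (conn σ α S) (S \ {d, α d}) ≤ numK σ α S := by
    rw [← h2]; exact Nat.le_add_right _ _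
  omega

/-- **No split when the two ends stay connected.** If any two surviving darts lying at the
vertex of `d` or at the vertex of `α d` are `S ∖ e`-connected, then
`numK (S ∖ e) ≤ numClasses (conn S) (S ∖ e)` (`≤ numK S`). -/
theorem IsRotSys.numK_sdiff_le_of_near_conn (h : IsRotSys σ α) (hS : IsClosed α S) (hd : d ∈ S)
    (hnear : ∀ w ∈ S \ {d, α d}, ∀ w' ∈ S \ {d, α d},
      (σ.SameCycle d w ∨ σ.SameCycle (α d) w) → (σ.SameCycle d w' ∨ σ.SameCycle (α d) w') →
      conn σ α (S \ {d, α d}) w w') :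
    numK σ α (S \ {d, α d}) ≤ numClasses (conn σ α S) (S \ {d, α d}) := by
  -- in this case `conn S` and `conn (S ∖ e)` agree on `S ∖ e`
  refine numClasses_le_of_imp (fun x _ => conn_refl σ α S x) (fun _ _ _ _ hc => conn_symm hc)
    (fun _ _ _ _ _ _ h1 h2 => conn_trans h1 h2) ?_
  intro x hx y hy hc
  rcases conn_sdiff_or hS hd hc with h1 | ⟨hxd, hyd⟩
  · exact h1
  · obtain ⟨w, hw, hxw, hnw⟩ := h.exists_near_of_conn hS hx hxd
    obtain ⟨w', hw', hyw', hnw'⟩ := h.exists_near_of_conn hS hy hyd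
    exact conn_trans hxw (conn_trans (hnear w hw w' hw' hnw hnw') (conn_symm hyw'))

end K

end RotSys

end Summit.Ventures.Crystal3D
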